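import Summits.CriticalPhenomena.SAWScalingLimit.Theses.SAWThetaPercolation

/-!
# Birth attack on `SAWThetaPercolation.ThetaWindowLimit` (stmt-CriticalPhenomena-17996) — junk-witness analysis

refuter-rattack-stmt-CriticalPhenomena-17996-0, 2026-08-17. `lean check` rc 0, no sorry.

Finding (not a refutation): the crux is satisfied by the DEGENERATE witnesses `P := 0`, `xs := 0`,
`ωs δ := 2 - δ` as soon as the pinch/wall-free event `E_ε` (the `let good` of the crux) is null for
some chordal SLE₆ law in every Dobrushin domain for all small `ε` (`PinchNull`): zero fugacity kills
every walk (`0 ^ (length + 1) = 0`), so the normalised contact-fugacity law is the zero measure and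
both halves of the crux converge to the zero measure.  Hence the non-triviality of the crux rests
entirely on the SLE₆ support property `μ (E_ε) > 0` for small `ε` (listed by the planner as an
unfiled layer-2 child); on paper it holds (driver uniformly small ⇒ thin hull with monotone tip
height ⇒ no `ε`-loops; domain Markov; final approach avoids a bounded hull with positive
probability), so `PinchNull` is false in reality, `P D` is then a probability measure and `xs ≡ 0`
is excluded by the test function `1`.  Recommended hardening anyway: require `0 < xs δ` eventually
(or `IsProbabilityMeasure (P D)`).  Note that under `PinchNull` the sibling crux `PinchFreeSLE6`
(stmt-17995) is false (a zero measure cannot converge in law to an SLE law), so `E_ε`-positivity is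
load-bearing for both items.
-/

open MeasureTheory Filter Topology Set
open Literature.Probability.RandomPlanarGeometry Literature.Probability.LatticeModels

namespace Summit.CriticalPhenomena.SAWScalingLimit.Cruxes.ThetaWindowLimit.BirthAttack

open Summit.CriticalPhenomena.SAWScalingLimit.Theses.SAWThetaPercolation

/-- The pinch/wall-free event `E_ε` of the crux (verbatim the `let good` of `ThetaWindowLimit`). -/
def goodSet (ε : ℝ) (D : DobrushinDomain) : Set (CurveClass ℂ) :=
  {c | (∀ γ : Curve ℂ, CurveClass.mk γ = c → ∀ s t : unitInterval, s < t → γ s = γ t →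
      Metric.diam (γ '' Set.Icc s t) < ε) ∧
    c.range ∩ frontier D.carrier ⊆ Metric.ball (D.pt 0) ε ∪ Metric.ball (D.pt 1) ε}

/-- Hypothesis `PinchNull`: in every Dobrushin domain some chordal SLE₆ law gives `E_ε` zero mass
for all small `ε > 0`. -/
def PinchNull : Prop :=
  ∀ D : DobrushinDomain, ∃ μ : Measure (CurveClass ℂ), IsSLELaw 6 D μ ∧
    ∀ᶠ ε in 𝓝[>] (0 : ℝ), μ (goodSet ε D) = 0

/-- Zero fugacity kills every walk: the contact-fugacity weight with `x = 0` is the zero measure. -/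
theorem weight_zero_fugacity {Ω : Set ℂ} {δ : ℝ} {a b : HexVertex} (ω : ℝ)
    (K : SAW.HexDomainSAW Ω δ a b → ℕ) :
    (Measure.sum fun γ : SAW.HexDomainSAW Ω δ a b =>
      ENNReal.ofReal ((0:ℝ) ^ γ.vertexCount * ω ^ (K γ)) • Measure.dirac γ) = 0 := by
  have h : ∀ γ : SAW.HexDomainSAW Ω δ a b, (0:ℝ) ^ γ.vertexCount = 0 := fun γ => by
    simp [SAW.EmbDomainSAW.vertexCount]
  simp [h]

/-- JUNK WITNESS MODULO `PinchNull`: `P := 0`, `xs := 0`, `ωs δ := 2 - δ`. -/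
theorem thetaWindowLimit_of_pinchNull (h : PinchNull) : ThetaWindowLimit := by
  unfold ThetaWindowLimit
  dsimp only
  refine ⟨fun _ => 0, ?_, fun δ => 2 - δ, fun _ => 0, ?_, ?_, ?_⟩
  · intro D
    obtain ⟨μ, hμ, hnull⟩ := h D
    refine ⟨μ, hμ, fun f => ?_⟩
    simp only [integral_zero_measure]
    refine tendsto_const_nhds.congr' ?_
    filter_upwards [hnull] with ε hε
    have hr : μ.restrict (goodSet ε D) = 0 := Measure.restrict_eq_zero.2 hε
    simp only [goodSet] at hr
    rw [hr, smul_zero, integral_zero_measure]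
  · have : Tendsto (fun δ : ℝ => 2 - δ) (𝓝 0) (𝓝 (2 - 0)) :=
      tendsto_const_nhds.sub tendsto_id
    simpa using this.mono_left nhdsWithin_le_nhds
  · filter_upwards [self_mem_nhdsWithin] with δ hδ
    simp only [Set.mem_Ioi] at hδ
    linarith
  · intro D a b _hab f
    have h0 : ∀ (δ : ℝ) (γ : SAW.HexDomainSAW D.carrier δ (a δ) (b δ)),
        (0:ℝ) ^ γ.vertexCount = 0 := fun δ γ => by
      simp [SAW.EmbDomainSAW.vertexCount]
    simp [h0]

end Summit.CriticalPhenomena.SAWScalingLimit.Cruxes.ThetaWindowLimit.BirthAttack
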